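import Summits.Ventures.PercRepro.S1CoreCapSpecSpreadSixBase

/-!
# PercRepro — TOWARDS THE INSTANCE `ν = 6` OF THE SPREAD SPEC: AT MOST THREE LINES MEET THE TRIANGLE-FREE BASE ONCE (p1, gen 32)

`proofs/P1-S2-CORANK6.md` §4h. Over the triangle-free base `[Y, X, A]` (rank `4`, `7` points, cost `3`) at nullity `6`, four lines
`P, Q, R, S` meeting the base once each cost `1 + 1 + …`: in every order the third is covered by the first two and the base or the fourth by
the first three and the base (`tf_seventh_covered`); a covered line meets two of the covering lines (`two_meet_of_subset`,
`both_meet_of_subset`). Three of the four lines pairwise meeting have a common point `q` (triangle-free), and then a covered line is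
`{q} ∪ (one point of the base)` — two points (`no_fourth_W_of_triangle`). Otherwise every line meets two of the others (`W_meets_two`, from
a disjoint pair among the other three), which forces a 4-cycle of meetings with two disjoint diagonals, refused by the spread clause
(`no_C4_W`: rank `4` on `8` points): **at most three lines meet the base once** (`tf_W_le_three_six`). Axioms: standard.
-/

namespace PercRepro

namespace S1

namespace FourCap

variable {β : Type} [DecidableEq β]

section SixLinesB

variable {w : β → ℕ} {ls : Finset (Finset β)}
  (hw1 : ∀ L ∈ ls, ∀ v ∈ L, w v = 1)
  (hcard : ∀ L ∈ ls, L.card = 3)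
  (h3 : ∀ L ∈ ls, ∀ L' ∈ ls, L ≠ L' → (L ∩ L').card ≤ 1)
  (h7 : ∀ l : List (Finset β), l.Nodup → (∀ L ∈ l, L ∈ ls) → lineRank l ≤ 4 → wsum w (unionL l) ≤ lineRank l + 3)

include hw1 hcard h3 in
/-- **The seventh line is covered**: over the base `[Y, X, A]` of rank `4` and `7` points at nullity `6`, four lines meeting the base once
cost `1 + 1 + …`, so the third is covered by the first two and the base, or the fourth by the first three and the base. -/
theorem tf_seventh_covered
    (h4 : ∀ l : List (Finset β), l.Nodup → (∀ L ∈ l, L ∈ ls) → wsum w (unionL l) ≤ 6 + lineRank l)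
    {A X Y : Finset β} (hA : A ∈ ls) (hX : X ∈ ls) (hY : Y ∈ ls) (hAX : A ≠ X) (hYA : Y ≠ A) (hYX' : Y ≠ X)
    (hrank : lineRank [Y, X, A] = 4) (hcardU : (unionL [Y, X, A]).card = 7)
    {P Q R S : Finset β} (hP : P ∈ ls) (hQ : Q ∈ ls) (hR : R ∈ ls) (hS : S ∈ ls) (hPA : P ≠ A) (hPX : P ≠ X) (hPY : P ≠ Y)
    (hQA : Q ≠ A) (hQX : Q ≠ X) (hQY : Q ≠ Y) (hRA : R ≠ A) (hRX : R ≠ X) (hRY : R ≠ Y) (hSA : S ≠ A) (hSX : S ≠ X)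
    (hSY : S ≠ Y) (hQP : Q ≠ P) (hRP : R ≠ P) (hRQ : R ≠ Q) (hSP : S ≠ P) (hSQ : S ≠ Q) (hSR : S ≠ R)
    (kP : (P ∩ unionL [Y, X, A]).card = 1) (kQ : (Q ∩ unionL [Y, X, A]).card = 1) :
    R ⊆ unionL [Q, P, Y, X, A] ∨ S ⊆ unionL [R, Q, P, Y, X, A] := by
  have hw : ∀ L ∈ ls, ∀ v ∈ L, 1 ≤ w v := fun L hL v hv => by rw [hw1 L hL v hv]
  have hc := h4 [S, R, Q, P, Y, X, A] (by simp [hAX.symm, hYA, hYX', hPA, hPX, hPY, hQA, hQX, hQY, hRA, hRX, hRY, hSA, hSX,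
    hSY, hQP, hRP, hRQ, hSP, hSQ, hSR]) (by simp [hA, hX, hY, hP, hQ, hR, hS])
  obtain ⟨a1, b1, c1, d1⟩ := cost_step w P [Y, X, A] (hw P hP)
  obtain ⟨a2, b2, c2, d2⟩ := cost_step w Q [P, Y, X, A] (hw Q hQ)
  obtain ⟨a3, b3, c3, d3⟩ := cost_step w R [Q, P, Y, X, A] (hw R hR)
  obtain ⟨a4, b4, c4, d4⟩ := cost_step w S [R, Q, P, Y, X, A] (hw S hS)
  have w1 := wsum_sdiff_eq_card hw1 hP (unionL [Y, X, A])
  have w2 := wsum_sdiff_eq_card hw1 hQ (unionL [P, Y, X, A])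
  have w3 := wsum_sdiff_eq_card hw1 hR (unionL [Q, P, Y, X, A])
  have w4 := wsum_sdiff_eq_card hw1 hS (unionL [R, Q, P, Y, X, A])
  have hwU : wsum w (unionL [Y, X, A]) = 7 := by
    rw [wsum_unionL_eq_card hw1 _ (by simp [hA, hX, hY]), hcardU]
  have e2 : unionL [P, Y, X, A] = P ∪ unionL [Y, X, A] := rfl
  have i2 : (Q ∩ unionL [P, Y, X, A]).card ≤ 2 := by
    rw [e2, Finset.inter_union_distrib_left]
    refine (Finset.card_union_le _ _).trans ?_
    have := h3 Q hQ P hP hQP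
    omega
  have kP' := hcard P hP
  have kQ' := hcard Q hQ
  have kR' := hcard R hR
  have kS' := hcard S hS
  rw [a4, a3, a2, a1, hwU, w1, w2, w3, w4, c4, c3, c2, c1, hrank] at hc
  have hor : (R \ unionL [Q, P, Y, X, A]).card = 0 ∨ (S \ unionL [R, Q, P, Y, X, A]).card = 0 := by omega
  rcases hor with h | h
  · exact Or.inl (Finset.sdiff_eq_empty_iff_subset.1 (Finset.card_eq_zero.1 h))
  · exact Or.inr (Finset.sdiff_eq_empty_iff_subset.1 (Finset.card_eq_zero.1 h))

include hcard h3 in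
/-- A line meeting the base once and contained in `R ∪ Q ∪ P ∪ base` meets two of `R, Q, P`. -/
theorem two_meet_of_subset {U : Finset β} {P Q R S : Finset β} (hP : P ∈ ls) (hQ : Q ∈ ls) (hR : R ∈ ls) (hS : S ∈ ls)
    (hSP : S ≠ P) (hSQ : S ≠ Q) (hSR : S ≠ R) (kS : (S ∩ U).card = 1) (hsub : S ⊆ R ∪ (Q ∪ (P ∪ U))) :
    ((S ∩ R).Nonempty ∧ (S ∩ Q).Nonempty) ∨ ((S ∩ R).Nonempty ∧ (S ∩ P).Nonempty) ∨
      ((S ∩ Q).Nonempty ∧ (S ∩ P).Nonempty) := by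
  have hcov : S ⊆ (S ∩ R) ∪ ((S ∩ Q) ∪ ((S ∩ P) ∪ (S ∩ U))) := by
    intro x hx
    have := hsub hx
    simp only [Finset.mem_union, Finset.mem_inter] at this ⊢
    tauto
  have hc1 := Finset.card_le_card hcov
  have hc2 := Finset.card_union_le (S ∩ R) ((S ∩ Q) ∪ ((S ∩ P) ∪ (S ∩ U)))
  have hc3 := Finset.card_union_le (S ∩ Q) ((S ∩ P) ∪ (S ∩ U))
  have hc4 := Finset.card_union_le (S ∩ P) (S ∩ U)
  have iR := h3 S hS R hR hSR
  have iQ := h3 S hS Q hQ hSQ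
  have iP := h3 S hS P hP hSP
  have := hcard S hS
  rcases (by omega : (1 ≤ (S ∩ R).card ∧ 1 ≤ (S ∩ Q).card) ∨ (1 ≤ (S ∩ R).card ∧ 1 ≤ (S ∩ P).card) ∨
      (1 ≤ (S ∩ Q).card ∧ 1 ≤ (S ∩ P).card)) with ⟨h1, h2⟩ | ⟨h1, h2⟩ | ⟨h1, h2⟩
  · exact Or.inl ⟨Finset.card_pos.1 h1, Finset.card_pos.1 h2⟩
  · exact Or.inr (Or.inl ⟨Finset.card_pos.1 h1, Finset.card_pos.1 h2⟩)
  · exact Or.inr (Or.inr ⟨Finset.card_pos.1 h1, Finset.card_pos.1 h2⟩)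

include hcard h3 in
/-- A line meeting the base once and contained in `Q ∪ P ∪ base` meets both `Q` and `P`. -/
theorem both_meet_of_subset {U : Finset β} {P Q R : Finset β} (hP : P ∈ ls) (hQ : Q ∈ ls) (hR : R ∈ ls) (hRP : R ≠ P)
    (hRQ : R ≠ Q) (kR : (R ∩ U).card = 1) (hsub : R ⊆ Q ∪ (P ∪ U)) : (R ∩ Q).Nonempty ∧ (R ∩ P).Nonempty := by
  have hcov : R ⊆ (R ∩ Q) ∪ ((R ∩ P) ∪ (R ∩ U)) := by
    intro x hx
    have := hsub hx
    simp only [Finset.mem_union, Finset.mem_inter] at this ⊢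
    tauto
  have hc1 := Finset.card_le_card hcov
  have hc2 := Finset.card_union_le (R ∩ Q) ((R ∩ P) ∪ (R ∩ U))
  have hc3 := Finset.card_union_le (R ∩ P) (R ∩ U)
  have iQ := h3 R hR Q hQ hRQ
  have iP := h3 R hR P hP hRP
  have := hcard R hR
  exact ⟨Finset.card_pos.1 (by omega), Finset.card_pos.1 (by omega)⟩

include hcard h3 in
/-- A line through the common point `q` of three others, with at most one point on each, and contained in their union with the base,
has at most two points. -/
theorem not_subset_of_common {U : Finset β} {P Q R S : Finset β} (hP : P ∈ ls) (hQ : Q ∈ ls) (hR : R ∈ ls) (hS : S ∈ ls)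
    (hSP : S ≠ P) (hSQ : S ≠ Q) (hSR : S ≠ R) (kS : (S ∩ U).card = 1) {q : β} (hqP : q ∈ P) (hqQ : q ∈ Q) (hqR : q ∈ R)
    (hqS : q ∈ S) (hsub : S ⊆ R ∪ (Q ∪ (P ∪ U))) : False := by
  have hcov : S ⊆ {q} ∪ (S ∩ U) := by
    intro x hx
    have := hsub hx
    simp only [Finset.mem_union] at this
    rw [Finset.mem_union, Finset.mem_singleton]
    rcases this with h | h | h | h
    · exact Or.inl (Finset.card_le_one.1 (h3 S hS R hR hSR) x (Finset.mem_inter.2 ⟨hx, h⟩) q (Finset.mem_inter.2 ⟨hqS, hqR⟩))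
    · exact Or.inl (Finset.card_le_one.1 (h3 S hS Q hQ hSQ) x (Finset.mem_inter.2 ⟨hx, h⟩) q (Finset.mem_inter.2 ⟨hqS, hqQ⟩))
    · exact Or.inl (Finset.card_le_one.1 (h3 S hS P hP hSP) x (Finset.mem_inter.2 ⟨hx, h⟩) q (Finset.mem_inter.2 ⟨hqS, hqP⟩))
    · exact Or.inr (Finset.mem_inter.2 ⟨hx, h⟩)
  have hc := Finset.card_le_card hcov
  have hu := Finset.card_union_le ({q} : Finset β) (S ∩ U)
  have := hcard S hS
  rw [Finset.card_singleton] at hu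
  omega

include hw1 hcard h3 in
/-- **Three pairwise meeting lines over the base leave no room for a fourth** (nullity `6`): they have a common point `q`, the third is
not covered by the other two (it would be `{q} ∪ base point`), so the fourth is covered, meets two of them, hence passes through `q` too,
and is `{q} ∪ base point` itself. -/
theorem no_fourth_W_of_triangle
    (h4 : ∀ l : List (Finset β), l.Nodup → (∀ L ∈ l, L ∈ ls) → wsum w (unionL l) ≤ 6 + lineRank l)
    (htf : ∀ X ∈ ls, ∀ Y ∈ ls, ∀ Z ∈ ls, X ≠ Y → Y ≠ Z → X ≠ Z → (X ∩ Y).Nonempty → (Y ∩ Z).Nonempty →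
      (X ∩ Z).Nonempty → (X ∩ Y ∩ Z).Nonempty)
    {A X Y : Finset β} (hA : A ∈ ls) (hX : X ∈ ls) (hY : Y ∈ ls) (hAX : A ≠ X) (hYA : Y ≠ A) (hYX' : Y ≠ X)
    (hrank : lineRank [Y, X, A] = 4) (hcardU : (unionL [Y, X, A]).card = 7)
    {P Q R S : Finset β} (hP : P ∈ ls) (hQ : Q ∈ ls) (hR : R ∈ ls) (hS : S ∈ ls) (hPA : P ≠ A) (hPX : P ≠ X) (hPY : P ≠ Y)
    (hQA : Q ≠ A) (hQX : Q ≠ X) (hQY : Q ≠ Y) (hRA : R ≠ A) (hRX : R ≠ X) (hRY : R ≠ Y) (hSA : S ≠ A) (hSX : S ≠ X)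
    (hSY : S ≠ Y) (hQP : Q ≠ P) (hRP : R ≠ P) (hRQ : R ≠ Q) (hSP : S ≠ P) (hSQ : S ≠ Q) (hSR : S ≠ R)
    (kP : (P ∩ unionL [Y, X, A]).card = 1) (kQ : (Q ∩ unionL [Y, X, A]).card = 1) (kR : (R ∩ unionL [Y, X, A]).card = 1)
    (kS : (S ∩ unionL [Y, X, A]).card = 1) (mPQ : (P ∩ Q).Nonempty) (mQR : (Q ∩ R).Nonempty) (mPR : (P ∩ R).Nonempty) :
    False := by
  obtain ⟨q, hq⟩ := htf P hP Q hQ R hR hQP.symm hRQ.symm hRP.symm mPQ mQR mPR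
  simp only [Finset.mem_inter] at hq
  have e3 : unionL [Q, P, Y, X, A] = Q ∪ (P ∪ unionL [Y, X, A]) := rfl
  have e4 : unionL [R, Q, P, Y, X, A] = R ∪ (Q ∪ (P ∪ unionL [Y, X, A])) := rfl
  rcases tf_seventh_covered hw1 hcard h3 h4 hA hX hY hAX hYA hYX' hrank hcardU hP hQ hR hS hPA hPX hPY hQA hQX hQY hRA hRX hRY
    hSA hSX hSY hQP hRP hRQ hSP hSQ hSR kP kQ with hR' | hS'
  · rw [e3] at hR'
    -- `R ⊆ Q ∪ P ∪ base` with `R ∩ Q = R ∩ P = {q}`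
    exact not_subset_of_common hcard h3 hP hQ hQ hR hRP hRQ hRQ kR hq.1.1 hq.1.2 hq.1.2 hq.2 (by
      intro x hx; have := hR' hx; simp only [Finset.mem_union] at this ⊢; tauto)
  · rw [e4] at hS'
    -- `S` meets two of `P, Q, R`, so passes through `q`
    have hqS : q ∈ S := by
      rcases two_meet_of_subset hcard h3 hP hQ hR hS hSP hSQ hSR kS hS' with ⟨m1, m2⟩ | ⟨m1, m2⟩ | ⟨m1, m2⟩
      · obtain ⟨q', hq'⟩ := htf Q hQ R hR S hS hRQ.symm hSR.symm hSQ.symm mQR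
          (by obtain ⟨x, hx⟩ := m1; exact ⟨x, by rw [Finset.inter_comm]; exact hx⟩)
          (by obtain ⟨x, hx⟩ := m2; exact ⟨x, by rw [Finset.inter_comm]; exact hx⟩)
        simp only [Finset.mem_inter] at hq'
        have : q' = q := Finset.card_le_one.1 (h3 Q hQ R hR hRQ.symm) q' (Finset.mem_inter.2 ⟨hq'.1.1, hq'.1.2⟩) q
          (Finset.mem_inter.2 ⟨hq.1.2, hq.2⟩)
        exact this ▸ hq'.2
      · obtain ⟨q', hq'⟩ := htf P hP R hR S hS hRP.symm hSR.symm hSP.symm mPR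
          (by obtain ⟨x, hx⟩ := m1; exact ⟨x, by rw [Finset.inter_comm]; exact hx⟩)
          (by obtain ⟨x, hx⟩ := m2; exact ⟨x, by rw [Finset.inter_comm]; exact hx⟩)
        simp only [Finset.mem_inter] at hq'
        have : q' = q := Finset.card_le_one.1 (h3 P hP R hR hRP.symm) q' (Finset.mem_inter.2 ⟨hq'.1.1, hq'.1.2⟩) q
          (Finset.mem_inter.2 ⟨hq.1.1, hq.2⟩)
        exact this ▸ hq'.2
      · obtain ⟨q', hq'⟩ := htf P hP Q hQ S hS hQP.symm hSQ.symm hSP.symm mPQ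
          (by obtain ⟨x, hx⟩ := m1; exact ⟨x, by rw [Finset.inter_comm]; exact hx⟩)
          (by obtain ⟨x, hx⟩ := m2; exact ⟨x, by rw [Finset.inter_comm]; exact hx⟩)
        simp only [Finset.mem_inter] at hq'
        have : q' = q := Finset.card_le_one.1 (h3 P hP Q hQ hQP.symm) q' (Finset.mem_inter.2 ⟨hq'.1.1, hq'.1.2⟩) q
          (Finset.mem_inter.2 ⟨hq.1.1, hq.1.2⟩)
        exact this ▸ hq'.2
    exact not_subset_of_common hcard h3 hP hQ hR hS hSP hSQ hSR kS hq.1.1 hq.1.2 hq.2 hqS hS'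

include hw1 hcard h3 in
/-- **Every line over the base meets two of the other three** when two of those are disjoint: in the order `Z, X', Y', W` with `X' ∩ Y' = ∅`
the third line is not covered, so the fourth is. -/
theorem W_meets_two
    (h4 : ∀ l : List (Finset β), l.Nodup → (∀ L ∈ l, L ∈ ls) → wsum w (unionL l) ≤ 6 + lineRank l)
    {A X Y : Finset β} (hA : A ∈ ls) (hX : X ∈ ls) (hY : Y ∈ ls) (hAX : A ≠ X) (hYA : Y ≠ A) (hYX' : Y ≠ X)
    (hrank : lineRank [Y, X, A] = 4) (hcardU : (unionL [Y, X, A]).card = 7)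
    {P Q R S : Finset β} (hP : P ∈ ls) (hQ : Q ∈ ls) (hR : R ∈ ls) (hS : S ∈ ls) (hPA : P ≠ A) (hPX : P ≠ X) (hPY : P ≠ Y)
    (hQA : Q ≠ A) (hQX : Q ≠ X) (hQY : Q ≠ Y) (hRA : R ≠ A) (hRX : R ≠ X) (hRY : R ≠ Y) (hSA : S ≠ A) (hSX : S ≠ X)
    (hSY : S ≠ Y) (hQP : Q ≠ P) (hRP : R ≠ P) (hRQ : R ≠ Q) (hSP : S ≠ P) (hSQ : S ≠ Q) (hSR : S ≠ R)
    (kP : (P ∩ unionL [Y, X, A]).card = 1) (kQ : (Q ∩ unionL [Y, X, A]).card = 1) (kR : (R ∩ unionL [Y, X, A]).card = 1)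
    (kS : (S ∩ unionL [Y, X, A]).card = 1) (hQR : Disjoint Q R) :
    ((S ∩ R).Nonempty ∧ (S ∩ Q).Nonempty) ∨ ((S ∩ R).Nonempty ∧ (S ∩ P).Nonempty) ∨
      ((S ∩ Q).Nonempty ∧ (S ∩ P).Nonempty) := by
  have e3 : unionL [Q, P, Y, X, A] = Q ∪ (P ∪ unionL [Y, X, A]) := rfl
  have e4 : unionL [R, Q, P, Y, X, A] = R ∪ (Q ∪ (P ∪ unionL [Y, X, A])) := rfl
  rcases tf_seventh_covered hw1 hcard h3 h4 hA hX hY hAX hYA hYX' hrank hcardU hP hQ hR hS hPA hPX hPY hQA hQX hQY hRA hRX hRY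
    hSA hSX hSY hQP hRP hRQ hSP hSQ hSR kP kQ with hR' | hS'
  · rw [e3] at hR'
    obtain ⟨m, _⟩ := both_meet_of_subset hcard h3 hP hQ hR hRP hRQ kR hR'
    exfalso
    obtain ⟨x, hx⟩ := m
    rw [Finset.mem_inter] at hx
    exact Finset.disjoint_left.1 hQR hx.2 hx.1
  · rw [e4] at hS'
    exact two_meet_of_subset hcard h3 hP hQ hR hS hSP hSQ hSR kS hS'

include hw1 hcard h3 h7 in
/-- **A 4-cycle of meetings with disjoint diagonals is refused by the spread clause**: the list `[Z₄, Z₂, Z₃, Z₁]` with `Z₁ ∩ Z₃ = ∅`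
and `Z₂, Z₄` each meeting both has rank bound `2 + 2 + 0 + 0 = 4` on `8` points. -/
theorem no_C4_W {Z₁ Z₂ Z₃ Z₄ : Finset β} (hZ₁ : Z₁ ∈ ls) (hZ₂ : Z₂ ∈ ls) (hZ₃ : Z₃ ∈ ls) (hZ₄ : Z₄ ∈ ls) (h21 : Z₂ ≠ Z₁)
    (h31 : Z₃ ≠ Z₁) (h32 : Z₃ ≠ Z₂) (h41 : Z₄ ≠ Z₁) (h42 : Z₄ ≠ Z₂) (h43 : Z₄ ≠ Z₃) (d13 : Disjoint Z₁ Z₃) (d24 : Disjoint Z₂ Z₄)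
    (m12 : (Z₁ ∩ Z₂).Nonempty) (m23 : (Z₂ ∩ Z₃).Nonempty) (m34 : (Z₃ ∩ Z₄).Nonempty) (m41 : (Z₄ ∩ Z₁).Nonempty) : False := by
  have k1 := hcard Z₁ hZ₁
  have k2 := hcard Z₂ hZ₂
  have k3 := hcard Z₃ hZ₃
  have k4 := hcard Z₄ hZ₄
  have c21 : (Z₂ ∩ Z₁).card = 1 := by
    have := h3 Z₂ hZ₂ Z₁ hZ₁ h21
    have : 1 ≤ (Z₂ ∩ Z₁).card := Finset.card_pos.2 (by obtain ⟨x, hx⟩ := m12; exact ⟨x, by rw [Finset.inter_comm]; exact hx⟩)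
    omega
  have c23 : (Z₂ ∩ Z₃).card = 1 := by
    have := h3 Z₂ hZ₂ Z₃ hZ₃ h32.symm
    have : 1 ≤ (Z₂ ∩ Z₃).card := Finset.card_pos.2 m23
    omega
  have c43 : (Z₄ ∩ Z₃).card = 1 := by
    have := h3 Z₄ hZ₄ Z₃ hZ₃ h43
    have : 1 ≤ (Z₄ ∩ Z₃).card := Finset.card_pos.2 (by obtain ⟨x, hx⟩ := m34; exact ⟨x, by rw [Finset.inter_comm]; exact hx⟩)
    omega
  have c41 : (Z₄ ∩ Z₁).card = 1 := by
    have := h3 Z₄ hZ₄ Z₁ hZ₁ h41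
    have : 1 ≤ (Z₄ ∩ Z₁).card := Finset.card_pos.2 m41
    omega
  have c31 : (Z₃ ∩ Z₁).card = 0 := by
    rw [Finset.card_eq_zero]; exact Finset.disjoint_iff_inter_eq_empty.1 d13.symm
  have u31 : (Z₃ ∪ Z₁).card = 6 := by
    rw [Finset.card_union_of_disjoint d13.symm, k3, k1]
  have i2 : (Z₂ ∩ (Z₃ ∪ Z₁)).card = 2 := by
    rw [Finset.inter_union_distrib_left, Finset.card_union_of_disjoint, c23, c21]
    exact Finset.disjoint_of_subset_left Finset.inter_subset_right
      (Finset.disjoint_of_subset_right Finset.inter_subset_right d13.symm)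
  have i4 : (Z₄ ∩ (Z₂ ∪ (Z₃ ∪ Z₁))).card = 2 := by
    rw [Finset.inter_union_distrib_left, Finset.disjoint_iff_inter_eq_empty.1 d24.symm, Finset.empty_union,
      Finset.inter_union_distrib_left, Finset.card_union_of_disjoint, c43, c41]
    exact Finset.disjoint_of_subset_left Finset.inter_subset_right
      (Finset.disjoint_of_subset_right Finset.inter_subset_right d13.symm)
  have s2 : (Z₂ \ (Z₃ ∪ Z₁)).card + (Z₂ ∩ (Z₃ ∪ Z₁)).card = Z₂.card := Finset.card_sdiff_add_card_inter _ _
  have s4 : (Z₄ \ (Z₂ ∪ (Z₃ ∪ Z₁))).card + (Z₄ ∩ (Z₂ ∪ (Z₃ ∪ Z₁))).card = Z₄.card := Finset.card_sdiff_add_card_inter _ _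
  have u2 : (Z₂ ∪ (Z₃ ∪ Z₁)).card + (Z₂ ∩ (Z₃ ∪ Z₁)).card = Z₂.card + (Z₃ ∪ Z₁).card := Finset.card_union_add_card_inter _ _
  have u4 : (Z₄ ∪ (Z₂ ∪ (Z₃ ∪ Z₁))).card + (Z₄ ∩ (Z₂ ∪ (Z₃ ∪ Z₁))).card = Z₄.card + (Z₂ ∪ (Z₃ ∪ Z₁)).card :=
    Finset.card_union_add_card_inter _ _
  have s3 : (Z₃ \ Z₁).card = 3 := by rw [Finset.sdiff_eq_self_of_disjoint d13.symm, k3]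
  have hb : ([Z₄, Z₂, Z₃, Z₁] : List (Finset β)).Nodup := by simp [h21, h31, h32.symm, h41, h42, h43]
  have hbl : ∀ L ∈ ([Z₄, Z₂, Z₃, Z₁] : List (Finset β)), L ∈ ls := by simp [hZ₁, hZ₂, hZ₃, hZ₄]
  have hr : lineRank [Z₄, Z₂, Z₃, Z₁] = 4 := by
    simp only [unionL, lineRank, Finset.union_empty, Finset.sdiff_empty, Finset.inter_empty, Finset.card_empty,
      Nat.zero_add]
    rw [show (2 - min 0 2 : ℕ) = 2 by decide, c31, s3, i2, i4, k1, show (2 - min 2 2 : ℕ) = 0 by decide]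
    omega
  have hsp := h7 _ hb hbl (by rw [hr])
  rw [hr, wsum_unionL_eq_card hw1 _ hbl] at hsp
  simp only [unionL, Finset.union_empty] at hsp
  omega

end SixLinesB

end FourCap

end S1

end PercRepro
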